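import Literature.Computability.AlgebraicComplexity.BorderRankMatMulThreeBridge
import Literature.Computability.AlgebraicComplexity.BorderRankMatMulThreeSigma
import HarnessLib

/-!
# Borel-fixed candidates of `⟨3,3,3⟩`: the `(011)`/`(101)` relabelings (integer data)

Topic `Literature/Computability/AlgebraicComplexity`. The product relabelings

* `MatMul3.σ₂ = f₂ × g₂ : (a, b) = ((i,k),(i',j)) ↦ ((rev k, i), (i', rev j)) ∈ B × C`,
* `MatMul3.σ₃ = f₃ × g₃ : (a, b) ↦ ((k, i), (rev j, i')) ∈ A × C`

(`BorderRankMatMulThreeSigma.lean`) identify the coordinates of the `(011)`-member `E₂ ≤ B ⊗ C` and the `(101)`-member `E₃ ≤ A ⊗ C`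
of a candidate triple of `⟨3,3,3⟩` with the `(110)` coordinates of
`BorderRankMatMulThreeBlocks.lean` (block `(j,k)`, position `(i,i')`, identity = a slice). This
file holds the kernel-checked integer facts: entrywise, the nine root moves of `E₂` (`Qm ⊗ Rm`)
resp. `E₃` (`Pm ⊗ Rm`) become the operators `ad X_{pq}`, `shiftV`, `shiftW` of the `(110)`
normal form (`E₂`: `V ↦ ad`, `U ↦ -shiftW`, `W ↦ -shiftV`; `E₃`: `W ↦ ad`, `U ↦ shiftW`,
`V ↦ -shiftV`; roots reversed where the group acts dually), and the torus weights in the new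
coordinates still isolate root coordinates and block diagonals. Consequences over a field are in
`BorderRankMatMulThreeTransport.lean`.

## References

* A. Conner, A. Harper, J. M. Landsberg, *New lower bounds for matrix multiplication and `det₃`*,
  Forum Math. Pi 11 (2023) e17, arXiv:1911.07981 — §2.5, §6. [ConnerHarperLandsberg2023]
-/

namespace Literature.Computability.AlgebraicComplexity

namespace BorderApolarity

namespace MatMul3

open TensorApolarity


/-! ## Integer identities for the transported moves (kernel-checked) -/

/-- Entries of `Qm ⊗ Rm` in `(110)` coordinates. [folklore] -/
def TZ₂ (g ρ : Fin 3) (c c' : I9 × I9) : ℤ := QZ g ρ (σ₂ c).1 (σ₂ c').1 * RZ g ρ (σ₂ c).2 (σ₂ c').2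

/-- Entries of `Qm' ⊗ Rm'` in `(110)` coordinates. [folklore] -/
def TZ₂' (g ρ : Fin 3) (c c' : I9 × I9) : ℤ :=
  QZ' g ρ (σ₂ c).1 (σ₂ c').1 * RZ' g ρ (σ₂ c).2 (σ₂ c').2

/-- Entries of `Pm ⊗ Rm` in `(110)` coordinates. [folklore] -/
def TZ₃ (g ρ : Fin 3) (c c' : I9 × I9) : ℤ := PZ g ρ (σ₃ c).1 (σ₃ c').1 * RZ g ρ (σ₃ c).2 (σ₃ c').2

/-- Entries of `Pm' ⊗ Rm'` in `(110)` coordinates. [folklore] -/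
def TZ₃' (g ρ : Fin 3) (c c' : I9 × I9) : ℤ :=
  PZ' g ρ (σ₃ c).1 (σ₃ c').1 * RZ' g ρ (σ₃ c).2 (σ₃ c').2

/-- On `E₂`, `U`-moves act as `1 - shiftW_{rev q, rev p}`. [cite: ConnerHarperLandsberg2023, §2.5] -/
theorem TZ₂_U : ∀ (ρ : Fin 3) (c c' : I9 × I9), TZ₂ 0 ρ c c' - (if c = c' then 1 else 0) =
    -shiftWZ (rootPQ ρ).2.rev (rootPQ ρ).1.rev c c' := by
  decide +kernel

/-- On `E₂`, `V`-moves satisfy `u - u⁻¹ = 2 ad X_{pq}`. [cite: ConnerHarperLandsberg2023, §2.5] -/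
theorem TZ₂_V : ∀ (ρ : Fin 3) (c c' : I9 × I9),
    TZ₂ 1 ρ c c' - TZ₂' 1 ρ c c' = 2 * adUZ (rootPQ ρ).1 (rootPQ ρ).2 c c' := by
  decide +kernel

/-- On `E₂`, `W`-moves act as `1 - shiftV_{rev q, rev p}`. [cite: ConnerHarperLandsberg2023, §2.5] -/
theorem TZ₂_W : ∀ (ρ : Fin 3) (c c' : I9 × I9), TZ₂ 2 ρ c c' - (if c = c' then 1 else 0) =
    -shiftVZ (rootPQ ρ).2.rev (rootPQ ρ).1.rev c c' := by
  decide +kernel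

/-- On `E₃`, `U`-moves act as `1 + shiftW_{pq}`. [cite: ConnerHarperLandsberg2023, §2.5] -/
theorem TZ₃_U : ∀ (ρ : Fin 3) (c c' : I9 × I9), TZ₃ 0 ρ c c' - (if c = c' then 1 else 0) =
    shiftWZ (rootPQ ρ).1 (rootPQ ρ).2 c c' := by
  decide +kernel

/-- On `E₃`, `V`-moves act as `1 - shiftV_{rev q, rev p}`. [cite: ConnerHarperLandsberg2023, §2.5] -/
theorem TZ₃_V : ∀ (ρ : Fin 3) (c c' : I9 × I9), TZ₃ 1 ρ c c' - (if c = c' then 1 else 0) =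
    -shiftVZ (rootPQ ρ).2.rev (rootPQ ρ).1.rev c c' := by
  decide +kernel

/-- On `E₃`, `W`-moves satisfy `u - u⁻¹ = 2 ad X_{pq}`. [cite: ConnerHarperLandsberg2023, §2.5] -/
theorem TZ₃_W : ∀ (ρ : Fin 3) (c c' : I9 × I9),
    TZ₃ 2 ρ c c' - TZ₃' 2 ρ c c' = 2 * adUZ (rootPQ ρ).1 (rootPQ ρ).2 c c' := by
  decide +kernel

/-- Every increasing pair is a reversed positive root. [folklore] -/
theorem exists_rootPQ_rev : ∀ p q : Fin 3, p < q →
    ∃ ρ : Fin 3, ((rootPQ ρ).2.rev, (rootPQ ρ).1.rev) = (p, q) := by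
  decide

/-! ## Weights in the new coordinates separate the coordinate classes (kernel-checked) -/

/-- A root coordinate is alone in its `E₂`-weight. [cite: ConnerHarperLandsberg2023, §2.5] -/
theorem wt₂_root_inj : ∀ c c' : I9 × I9, c.1.1 ≠ c.2.1 →
    wt₁ eB eC (σ₂ c') = wt₁ eB eC (σ₂ c) → c' = c := by
  decide +kernel

/-- The coordinates of the `E₂`-weight of a block diagonal are that block diagonal.
[cite: ConnerHarperLandsberg2023, §2.5] -/
theorem wt₂_diag_iff : ∀ (c : I9 × I9) (j k : Fin 3),
    wt₁ eB eC (σ₂ c) = wt₁ eB eC (σ₂ (blk j k 0 0)) ↔ (c.1.2 = k ∧ c.2.2 = j ∧ c.1.1 = c.2.1) := by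
  decide +kernel

/-- A root coordinate is alone in its `E₃`-weight. [cite: ConnerHarperLandsberg2023, §2.5] -/
theorem wt₃_root_inj : ∀ c c' : I9 × I9, c.1.1 ≠ c.2.1 →
    wt₁ eA eC (σ₃ c') = wt₁ eA eC (σ₃ c) → c' = c := by
  decide +kernel

/-- The coordinates of the `E₃`-weight of a block diagonal are that block diagonal.
[cite: ConnerHarperLandsberg2023, §2.5] -/
theorem wt₃_diag_iff : ∀ (c : I9 × I9) (j k : Fin 3),
    wt₁ eA eC (σ₃ c) = wt₁ eA eC (σ₃ (blk j k 0 0)) ↔ (c.1.2 = k ∧ c.2.2 = j ∧ c.1.1 = c.2.1) := by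
  decide +kernel

end MatMul3

end BorderApolarity

end Literature.Computability.AlgebraicComplexity
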